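/-
Copyright (c) 2026 the pub-hodgecm-mathlib formalisation cell (harness21).  Prover seat hodgecm-mathlib-F0P3a-p07 (g19): ROAD «HC-D» (holder F0P2-p01 (g23)),
brick D5(iv)+GLOBAL «ASSEMBLY ON THE LIE ALGEBRA», 2026-09-02.
-/
import Literature.MeasureTheory.Group.LocFiniteLIntegralProductTransfer     -- ★ p852081 (this seat) (G-FUB): product ∕ one-factor transfers, assembly shape
import Literature.MeasureTheory.Integral.HomogeneousVertexIntegrability      -- ★ p852064 (LH10-p01) (D3v): `forall_exists_nhds_setLIntegral_lt_top_of_homogeneous_pi`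
import Literature.LinearAlgebra.Matrix.CubicCharpolyDiscrNonRegular          -- ★ p852036 (F0P3-p02) (D4c): `discr_smul_fin_three`, `discr_add_smul_one_fin_three`
import Literature.LinearAlgebra.Matrix.RegularSemisimpleConjClassClosed       -- ★ `continuous_charpoly_coeff`
import Literature.NumberTheory.Automorphic.TateLocalZetaShells                -- ★ `secondCountableTopology_localField`, `exists_normAbs_eq_inv` (brings ★ `LocalFieldHaar.continuous_normAbs`, `normAbs`)
import HarnessLib

/-!
# ROAD «HC-D», brick D5(iv)+GLOBAL: `|η|^{−1∕2}` is locally `∫⁻`-finite on the unitary Lie algebra — the assembly (case split, vertex, centre-Fubini)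

Cell `pub/hodgecm-mathlib`, crux H413 = `stmt-HodgeConjecture-24833` (lane `--supports … --as helper`), route HCCMUnconditional; ROAD «HC-D» (holder
F0P2-p01 (g23); CENSUS-HCD v1 §1 (iv) + GLOBAL; RULINGS R1–R5 16:24:15Z, R3♭ «THERE IS NO F» 16:29:10Z).  THEOREMS ONLY; ★-only imports.  HONEST LABEL: HC_CM is
proved only modulo the 7 printed citations (2 remaining named inputs: hLiu418 = `stmt-HodgeConjecture-24832`, h413 = `stmt-HodgeConjecture-24833`) until rung 0
closes; this file is count-neutral (pays no organ, opens no road).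

THE OBJECTS (R2∕R3∕R5 tokens).  `K` a non-archimedean local field, `σ : K →+* K` continuous (its being an involution is never used in this file), `J : Matrix (Fin 3) (Fin 3) K` with `IsUnit J.det`;
the Lie algebra is an ARBITRARY additive subgroup `𝔲 ≤ M₃(K)` with `X ∈ 𝔲 ↔ (X.map σ)ᵀ * J + J * X = 0`, its trace-zero part `𝔲₀` with
`X ∈ 𝔲₀ ↔ (X.map σ)ᵀ * J + J * X = 0 ∧ trace X = 0`; `μ₀`, `μ` ANY additive Haar measures on `↥𝔲₀`, `↥𝔲`.  The integrand is the R2 token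
`ηι X := (↑(√(√(normAbs K (charpoly X).discr))) : ℝ≥0∞)⁻¹` (`= |η(X)|_{F}^{−1∕2}` for the fixed field `F`, since `normAbs_K = normAbs_F²` on `F`; `= ⊤` exactly on the
discriminant locus); «locally finite at `X₀`» means `∃ U ∈ 𝓝 X₀, ∫⁻ X in U, ηι X ∂μ < ∞`.

THE MATHEMATICS.
* §0 `ηι` is continuous, hence measurable, on `↥𝔲₀` (cubic discriminant = polynomial in the coefficients of `charpoly`, ★ `continuous_charpoly_coeff`, ★ `continuous_normAbs`).
* §1 CASE SPLIT on `↥𝔲₀` (pure logic over the R5 token `LinearIndependent K ![1, X, X²]`): local finiteness at every `X₀ : ↥𝔲₀` follows from three inputs imported BY NAME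
  as hypotheses until ★ — `hreg` (D5(i), regular points), `hnonreg` (D5(ii)+(iii), non-regular `X₀ ≠ 0`), `hvertex` (D5(iv), the implication «off `0` ⇒ everywhere»).
* §2 THE VERTEX `hvertex` DISCHARGED from the coordinate isomorphism (CO) `Φ₀ : (Fin 8 → F′) ≃ₜ+ ↥𝔲₀` (F0P2-p06; letters: scaling equivariance
  `↑(Φ₀ (l • a)) = ι l • ↑(Φ₀ a)` and the norm bridge `normAbs K (ι x) = normAbs F′ x ^ 2`): `ηι (ι ϖ • X) = q³ · ηι X` (★ `discr_smul_fin_three`: `η` is homogeneous of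
  degree `6`; `normAbs K (ι ϖ) = q⁻²`), so ★ (D3v) `forall_exists_nhds_setLIntegral_lt_top_of_homogeneous_pi` on `Fin 8 → F′` (`a = ϖ`, `k = 1`, `c = q³ < q⁸`) and the
  one-factor transfer ★ (G-FUB) `…_iff_of_addEquiv` along `Φ₀` give the vertex.
* §3 CENTRE-FUBINI `↥𝔲₀ ⇒ ↥𝔲`: `e : ↥K⁻ × ↥𝔲₀ ≃ₜ+ ↥𝔲`, `e (z, Y) = z • 1 + Y` (`K⁻ = ker (σ + id)`, the skew scalars; inverse `X ↦ (trace X ∕ 3, X − (trace X ∕ 3) • 1)` —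
  HERE `(3 : K) ≠ 0` is used: in characteristic `3` the centre lies inside `𝔲₀`), `ηι (z • 1 + Y) = ηι Y` (★ `discr_add_smul_one_fin_three`), then ★ (G-FUB)
  `forall_exists_nhds_setLIntegral_lt_top_iff_of_prod` (any Haar measures; constants absorbed).
* §3 also: the splitting ∃-packaged (`exists_centreSplitting`), reused by the sequel `…HCDLieGlobalDescent` (pointwise descent `↥𝔲 ⇒ ↥𝔲₀` and the variant of §4 with
  local inputs stated on `↥𝔲`).
* §4 THE COMBINED HEAD `forall_exists_nhds_setLIntegral_etaInv_lt_top_of_local` (local inputs on `↥𝔲₀`, R3 of record): GLOBAL on `↥𝔲` from `hreg`, `hnonreg` and the (CO)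
  letters; consumed by D6(a) (F0P3a-p06) and D7.

## References
* [HarishChandra1970] Harish-Chandra (notes by G. van Dijk), *Harmonic Analysis on Reductive p-adic Groups*, LNM 162 (1970), Part VII §1 Thm. 15 (`|D|^{−1∕2}` locally summable —
  the statement this road proves for `U(3)` by charts; this file is its Lie-algebra assembly step).
* [Folland1999] G. B. Folland, *Real Analysis* (2nd ed., 1999), §2.5 Thm. 2.37, §11.1 Thm. 11.9 (Tonelli; uniqueness of Haar measure).
-/

set_option autoImplicit false
-- the mandated namespace has the single-problem summit's repeated segment (`HodgeConjecture.HodgeConjecture`)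
set_option linter.dupNamespace false

noncomputable section

open MeasureTheory MeasureTheory.Measure Filter Topology Set Matrix Finset
open scoped ENNReal NNReal Topology Matrix
open Literature.NumberTheory.GaloisRepresentations Literature.NumberTheory.Automorphic Literature.MeasureTheory.Group Literature.MeasureTheory.Integral
open Literature.LinearAlgebra.Matrix

namespace Summit.HodgeConjecture.HodgeConjecture.Cruxes.H413.F0P3cStCharTSHCDLieGlobal

variable {K : Type*} [Field K] [ValuativeRel K] [TopologicalSpace K] [IsNonarchimedeanLocalField K]

/-! ## §0 The integrand `ηι` is continuous, hence measurable -/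

/-- `X ↦ discr (charpoly X)` is continuous on `M₃(K)` (a polynomial in the coefficients of the characteristic polynomial — Mathlib `discr_of_degree_eq_three` —
which are continuous, ★ `continuous_charpoly_coeff`). [cite: Folland1999, §2.5 Thm. 2.37] -/
theorem continuous_charpoly_discr : Continuous fun X : Matrix (Fin 3) (Fin 3) K => X.charpoly.discr := by
  have hc : ∀ i : ℕ, Continuous fun X : Matrix (Fin 3) (Fin 3) K => X.charpoly.coeff i := fun i => continuous_charpoly_coeff i
  have heq : (fun X : Matrix (Fin 3) (Fin 3) K => X.charpoly.discr) = fun X : Matrix (Fin 3) (Fin 3) K =>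
      X.charpoly.coeff 2 ^ 2 * X.charpoly.coeff 1 ^ 2 - 4 * X.charpoly.coeff 3 * X.charpoly.coeff 1 ^ 3 - 4 * X.charpoly.coeff 2 ^ 3 * X.charpoly.coeff 0
        - 27 * X.charpoly.coeff 3 ^ 2 * X.charpoly.coeff 0 ^ 2 + 18 * X.charpoly.coeff 3 * X.charpoly.coeff 2 * X.charpoly.coeff 1 * X.charpoly.coeff 0 := by
    funext X
    exact Polynomial.discr_of_degree_eq_three (by rw [Matrix.charpoly_degree_eq_dim]; rfl)
  rw [heq]
  fun_prop

/-- **`ηι` is continuous on `M₃(K)`** (away from the discriminant locus it is finite; on it `= ⊤`; `ℝ≥0∞` inversion is continuous). [cite: Folland1999, §2.5 Thm. 2.37] -/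
theorem continuous_etaInv : Continuous fun X : Matrix (Fin 3) (Fin 3) K =>
    ((NNReal.sqrt (NNReal.sqrt (IsNonarchimedeanLocalField.normAbs K (Matrix.charpoly X).discr)) : ℝ≥0∞))⁻¹ := by
  refine Continuous.inv (ENNReal.continuous_coe.comp ?_)
  exact NNReal.continuous_sqrt.comp (NNReal.continuous_sqrt.comp (LocalFieldHaar.continuous_normAbs.comp continuous_charpoly_discr))

/-- **`ηι` restricted to any subgroup `𝔲₀ ≤ M₃(K)` is measurable** (Borel structure on the subtype). [cite: Folland1999, §2.5 Thm. 2.37] -/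
theorem measurable_etaInv_subtype (𝔲₀ : AddSubgroup (Matrix (Fin 3) (Fin 3) K)) [MeasurableSpace ↥𝔲₀] [BorelSpace ↥𝔲₀] :
    Measurable fun X : ↥𝔲₀ =>
      ((NNReal.sqrt (NNReal.sqrt (IsNonarchimedeanLocalField.normAbs K (Matrix.charpoly (X : Matrix (Fin 3) (Fin 3) K)).discr)) : ℝ≥0∞))⁻¹ :=
  (continuous_etaInv.comp continuous_subtype_val).measurable

/-! ## §1 The case split on `↥𝔲₀` (pure logic over the regularity token R5) -/

/-- **GLOBAL ON THE TRACE-ZERO PART FROM THE THREE LOCAL INPUTS**: if `ηι` is locally `∫⁻`-finite at every REGULAR `X₀ : ↥𝔲₀` (`hreg` = D5(i)), at every NON-REGULAR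
`X₀ ≠ 0` (`hnonreg` = D5(ii)+(iii)), and local finiteness off `0` implies it everywhere (`hvertex` = D5(iv), §2), then `ηι` is locally `∫⁻`-finite at every point of `↥𝔲₀`.
Regularity token R5: `LinearIndependent K ![1, X, X ^ 2]`. [cite: HarishChandra1970, Part VII §1 Thm. 15] -/
theorem forall_exists_nhds_setLIntegral_etaInv_lt_top_traceZero (𝔲₀ : AddSubgroup (Matrix (Fin 3) (Fin 3) K)) [MeasurableSpace ↥𝔲₀] (μ₀ : Measure ↥𝔲₀)
    (hreg : ∀ X₀ : ↥𝔲₀, LinearIndependent K ![(1 : Matrix (Fin 3) (Fin 3) K), (X₀ : Matrix (Fin 3) (Fin 3) K), (X₀ : Matrix (Fin 3) (Fin 3) K) ^ 2] →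
      ∃ U ∈ 𝓝 X₀, ∫⁻ X in U, ((NNReal.sqrt (NNReal.sqrt (IsNonarchimedeanLocalField.normAbs K (Matrix.charpoly (X : Matrix (Fin 3) (Fin 3) K)).discr)) : ℝ≥0∞))⁻¹ ∂μ₀ < ∞)
    (hnonreg : ∀ X₀ : ↥𝔲₀, X₀ ≠ 0 → ¬ LinearIndependent K ![(1 : Matrix (Fin 3) (Fin 3) K), (X₀ : Matrix (Fin 3) (Fin 3) K), (X₀ : Matrix (Fin 3) (Fin 3) K) ^ 2] →
      ∃ U ∈ 𝓝 X₀, ∫⁻ X in U, ((NNReal.sqrt (NNReal.sqrt (IsNonarchimedeanLocalField.normAbs K (Matrix.charpoly (X : Matrix (Fin 3) (Fin 3) K)).discr)) : ℝ≥0∞))⁻¹ ∂μ₀ < ∞)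
    (hvertex : (∀ X₀ : ↥𝔲₀, X₀ ≠ 0 →
        ∃ U ∈ 𝓝 X₀, ∫⁻ X in U, ((NNReal.sqrt (NNReal.sqrt (IsNonarchimedeanLocalField.normAbs K (Matrix.charpoly (X : Matrix (Fin 3) (Fin 3) K)).discr)) : ℝ≥0∞))⁻¹ ∂μ₀ < ∞) →
      ∀ X₀ : ↥𝔲₀, ∃ U ∈ 𝓝 X₀, ∫⁻ X in U, ((NNReal.sqrt (NNReal.sqrt (IsNonarchimedeanLocalField.normAbs K (Matrix.charpoly (X : Matrix (Fin 3) (Fin 3) K)).discr)) : ℝ≥0∞))⁻¹ ∂μ₀ < ∞) :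
    ∀ X₀ : ↥𝔲₀, ∃ U ∈ 𝓝 X₀,
      ∫⁻ X in U, ((NNReal.sqrt (NNReal.sqrt (IsNonarchimedeanLocalField.normAbs K (Matrix.charpoly (X : Matrix (Fin 3) (Fin 3) K)).discr)) : ℝ≥0∞))⁻¹ ∂μ₀ < ∞ := by
  refine hvertex fun X₀ hX₀ => ?_
  by_cases h : LinearIndependent K ![(1 : Matrix (Fin 3) (Fin 3) K), (X₀ : Matrix (Fin 3) (Fin 3) K), (X₀ : Matrix (Fin 3) (Fin 3) K) ^ 2]
  · exact hreg X₀ h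
  · exact hnonreg X₀ hX₀ h

/-! ## §2 The vertex from the coordinate isomorphism (CO) and ★ (D3v) -/

section Vertex

variable {F' : Type*} [Field F'] [ValuativeRel F'] [TopologicalSpace F'] [IsNonarchimedeanLocalField F']

/-- **HOMOGENEITY OF `ηι`**: `ηι (t • Y) = (normAbs K t ^ 6)^{−1∕4}… ` concretely: if `normAbs K t = r ^ 2` then `√(√(normAbs K (discr (charpoly (t • Y))))) = r ^ 3 * √(√(normAbs K
(discr (charpoly Y))))` (★ `discr_smul_fin_three`: `η (t • Y) = t⁶ η Y`). [cite: HarishChandra1970, Part VII §1 Thm. 15] -/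
theorem sqrt_sqrt_normAbs_discr_smul (t : K) (r : ℝ≥0) (ht : IsNonarchimedeanLocalField.normAbs K t = r ^ 2) (Y : Matrix (Fin 3) (Fin 3) K) :
    NNReal.sqrt (NNReal.sqrt (IsNonarchimedeanLocalField.normAbs K (Matrix.charpoly (t • Y)).discr)) =
      r ^ 3 * NNReal.sqrt (NNReal.sqrt (IsNonarchimedeanLocalField.normAbs K (Matrix.charpoly Y).discr)) := by
  have h1 : (Matrix.charpoly (t • Y)).discr = t ^ 6 * (Matrix.charpoly Y).discr := discr_smul_fin_three t Y
  rw [h1, map_mul, map_pow, ht, ← pow_mul, show 2 * 6 = 12 from rfl, NNReal.sqrt_mul, show r ^ 12 = (r ^ 6) ^ 2 by ring, NNReal.sqrt_sq,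
    NNReal.sqrt_mul, show r ^ 6 = (r ^ 3) ^ 2 by ring, NNReal.sqrt_sq]

/-- **THE VERTEX ON `↥𝔲₀` (D5(iv)).**  Carriers: any additive subgroup `𝔲₀ ≤ M₃(K)` with an additive Haar measure `μ₀`; a non-archimedean local field `F′` with a ring
map `ι : F′ →+* K` satisfying the NORM BRIDGE `normAbs K (ι x) = normAbs F′ x ^ 2` (quadratic `K ∕ ι F′`); the COORDINATE ISOMORPHISM (CO) `Φ₀ : (Fin 8 → F′) ≃ₜ+ ↥𝔲₀` with
scaling equivariance `↑(Φ₀ (l • a)) = ι l • ↑(Φ₀ a)`.  If `ηι` is locally `∫⁻`-finite at every `X₀ ≠ 0` of `↥𝔲₀`, it is so at every `X₀` (incl. `0`): in coordinates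
`g := ηι ∘ Φ₀` satisfies `g (ϖ • a) = q³ · g a` (`ϖ` a uniformizer of `F′`, `η` homogeneous of degree `6`, `normAbs K (ι ϖ) = q⁻²`), `q³ < q⁸`, so ★ (D3v)
`forall_exists_nhds_setLIntegral_lt_top_of_homogeneous_pi` applies, and local finiteness moves along `Φ₀` both ways by ★ (G-FUB) `…_iff_of_addEquiv` (any Haar
measures). [cite: HarishChandra1970, Part VII §1 Thm. 15] [cite: Folland1999, §11.1 Thm. 11.9] -/
theorem forall_exists_nhds_setLIntegral_etaInv_lt_top_traceZero_of_off_zero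
    (𝔲₀ : AddSubgroup (Matrix (Fin 3) (Fin 3) K)) [MeasurableSpace ↥𝔲₀] [BorelSpace ↥𝔲₀] (μ₀ : Measure ↥𝔲₀) [μ₀.IsAddHaarMeasure]
    (ι : F' →+* K) (hιn : ∀ x : F', IsNonarchimedeanLocalField.normAbs K (ι x) = IsNonarchimedeanLocalField.normAbs F' x ^ 2)
    (Φ₀ : (Fin 8 → F') ≃ₜ+ ↥𝔲₀)
    (hΦ₀ : ∀ (l : F') (a : Fin 8 → F'), ((Φ₀ (l • a) : ↥𝔲₀) : Matrix (Fin 3) (Fin 3) K) = ι l • ((Φ₀ a : ↥𝔲₀) : Matrix (Fin 3) (Fin 3) K))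
    (hoff : ∀ X₀ : ↥𝔲₀, X₀ ≠ 0 →
      ∃ U ∈ 𝓝 X₀, ∫⁻ X in U, ((NNReal.sqrt (NNReal.sqrt (IsNonarchimedeanLocalField.normAbs K (Matrix.charpoly (X : Matrix (Fin 3) (Fin 3) K)).discr)) : ℝ≥0∞))⁻¹ ∂μ₀ < ∞) :
    ∀ X₀ : ↥𝔲₀, ∃ U ∈ 𝓝 X₀,
      ∫⁻ X in U, ((NNReal.sqrt (NNReal.sqrt (IsNonarchimedeanLocalField.normAbs K (Matrix.charpoly (X : Matrix (Fin 3) (Fin 3) K)).discr)) : ℝ≥0∞))⁻¹ ∂μ₀ < ∞ := by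
  classical
  -- instances on the coordinate space `Fin 8 → F′`
  haveI : T2Space F' := (IsNonarchimedeanLocalField.isLocalField F').toT2Space
  haveI := secondCountableTopology_localField F'
  letI : MeasurableSpace F' := borel F'
  haveI : BorelSpace F' := ⟨rfl⟩
  -- instances on `↥𝔲₀`, transported from the coordinates
  haveI : LocallyCompactSpace ↥𝔲₀ := Φ₀.toHomeomorph.symm.isClosedEmbedding.locallyCompactSpace
  haveI : SecondCountableTopology ↥𝔲₀ := Φ₀.toHomeomorph.symm.secondCountableTopology
  set ν : Measure (Fin 8 → F') := Measure.addHaar with hν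
  -- the integrand and its coordinate form
  set f : ↥𝔲₀ → ℝ≥0∞ := fun X =>
    ((NNReal.sqrt (NNReal.sqrt (IsNonarchimedeanLocalField.normAbs K (Matrix.charpoly (X : Matrix (Fin 3) (Fin 3) K)).discr)) : ℝ≥0∞))⁻¹ with hfdef
  -- a uniformizer of `F′` and the constants
  obtain ⟨ϖ, _, hϖ⟩ := exists_normAbs_eq_inv (F := F')
  set q : ℝ≥0 := (IsNonarchimedeanLocalField.residueFieldCard F' : ℝ≥0) with hqdef
  have hq1n : 1 < IsNonarchimedeanLocalField.residueFieldCard F' := IsNonarchimedeanLocalField.one_lt_residueFieldCard F'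
  have hq1 : 1 < q := by rw [hqdef]; exact_mod_cast hq1n
  have hq0 : q ≠ 0 := (zero_lt_one.trans hq1).ne'
  have hqc : (q : ℝ≥0∞) = ((IsNonarchimedeanLocalField.residueFieldCard F' : ℕ) : ℝ≥0∞) := by rw [hqdef, ENNReal.coe_natCast]
  -- homogeneity in coordinates: `f (Φ₀ (ϖ • a)) = q³ · f (Φ₀ a)`
  have hhom : ∀ a : Fin 8 → F', a ≠ 0 →
      f (Φ₀ (fun i => ϖ * a i)) ≤ ((IsNonarchimedeanLocalField.residueFieldCard F' : ℕ) : ℝ≥0∞) ^ 3 * f (Φ₀ a) := by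
    intro a _
    have hsm : (fun i => ϖ * a i) = ϖ • a := by funext i; simp [Pi.smul_apply, smul_eq_mul]
    rw [hsm, ← hqc]
    simp only [hfdef]
    rw [hΦ₀ ϖ a, sqrt_sqrt_normAbs_discr_smul (ι ϖ) q⁻¹ (by rw [hιn, hϖ]) _]
    have hr0 : ((q⁻¹ ^ 3 : ℝ≥0) : ℝ≥0∞) ≠ 0 := by exact_mod_cast pow_ne_zero 3 (inv_ne_zero hq0)
    rw [ENNReal.coe_mul, ENNReal.mul_inv (Or.inl hr0) (Or.inl ENNReal.coe_ne_top), ENNReal.coe_pow, ENNReal.coe_inv hq0,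
      ENNReal.inv_pow, inv_inv]
  have hc : ((IsNonarchimedeanLocalField.residueFieldCard F' : ℕ) : ℝ≥0∞) ^ 3 <
      (IsNonarchimedeanLocalField.residueFieldCard F' : ℝ≥0∞) ^ (∑ _i : Fin 8, (1 : ℕ)) := by
    rw [Finset.sum_const, Finset.card_univ, Fintype.card_fin, smul_eq_mul, mul_one]
    exact_mod_cast Nat.pow_lt_pow_right hq1n (by norm_num)
  -- off-zero finiteness in coordinates
  have hoff' : ∀ a : Fin 8 → F', a ≠ 0 → ∃ U ∈ 𝓝 a, ∫⁻ x in U, f (Φ₀ x) ∂ν < ∞ := by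
    intro a ha
    have hΦa : Φ₀ a ≠ 0 := fun h => ha (Φ₀.injective (by rw [h, map_zero]))
    exact (exists_nhds_setLIntegral_lt_top_iff_of_addEquiv Φ₀ ν μ₀ f a).1 (hoff (Φ₀ a) hΦa)
  -- ★ (D3v) on the coordinate space
  have hall := forall_exists_nhds_setLIntegral_lt_top_of_homogeneous_pi ν (fun _ : Fin 8 => ϖ) (fun _ => 1) (fun _ => le_rfl)
    (fun _ => by rw [pow_one, hϖ]) (fun x => f (Φ₀ x)) (((IsNonarchimedeanLocalField.residueFieldCard F' : ℕ) : ℝ≥0∞) ^ 3) hhom hc hoff'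
  -- back to `↥𝔲₀`
  exact (forall_exists_nhds_setLIntegral_lt_top_iff_of_addEquiv Φ₀ ν μ₀ f).2 hall

end Vertex

/-! ## §3 Centre-Fubini: from the trace-zero part `↥𝔲₀` to `↥𝔲` -/

section Centre

variable (σ : K →+* K)

omit [ValuativeRel K] [TopologicalSpace K] [IsNonarchimedeanLocalField K] in
/-- The skew scalars `K⁻ = {z | σ z = −z}` as the kernel of the additive map `σ + id` (no new definition). [cite: Folland1999, §11.1 Thm. 11.9] -/
theorem mem_ker_add_id_iff (z : K) : z ∈ ((σ : K →+* K).toAddMonoidHom + AddMonoidHom.id K).ker ↔ σ z = -z := by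
  rw [AddMonoidHom.mem_ker, AddMonoidHom.add_apply, RingHom.toAddMonoidHom_eq_coe, AddMonoidHom.coe_coe, AddMonoidHom.id_apply, add_eq_zero_iff_eq_neg]

omit [ValuativeRel K] [TopologicalSpace K] [IsNonarchimedeanLocalField K] in
/-- For `X ∈ 𝔲` (`(X.map σ)ᵀ J + J X = 0`, `J` invertible) the trace is a skew scalar: `σ (trace X) = − trace X` (`X = −J⁻¹ (X.map σ)ᵀ J`).
[cite: HarishChandra1970, Part VII §1 Thm. 15] -/
theorem map_trace_eq_neg_of_mem {J : Matrix (Fin 3) (Fin 3) K} (hJd : IsUnit J.det) {X : Matrix (Fin 3) (Fin 3) K}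
    (hX : (X.map σ)ᵀ * J + J * X = 0) : σ (Matrix.trace X) = -Matrix.trace X := by
  have hJu : IsUnit J := (Matrix.isUnit_iff_isUnit_det J).2 hJd
  obtain ⟨Ju, rfl⟩ := hJu
  have hX' : X = -(((Ju⁻¹ : (Matrix (Fin 3) (Fin 3) K)ˣ) : Matrix (Fin 3) (Fin 3) K) * (X.map σ)ᵀ * (Ju : Matrix (Fin 3) (Fin 3) K)) := by
    have h1 : (Ju : Matrix (Fin 3) (Fin 3) K) * X = -((X.map σ)ᵀ * (Ju : Matrix (Fin 3) (Fin 3) K)) := eq_neg_of_add_eq_zero_right hX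
    calc X = ((Ju⁻¹ : (Matrix (Fin 3) (Fin 3) K)ˣ) : Matrix (Fin 3) (Fin 3) K) * ((Ju : Matrix (Fin 3) (Fin 3) K) * X) := by
          rw [← Matrix.mul_assoc, Units.inv_mul, Matrix.one_mul]
      _ = _ := by rw [h1, Matrix.mul_neg, Matrix.mul_assoc]
  have htrmap : Matrix.trace (X.map σ) = σ (Matrix.trace X) := by
    simp [Matrix.trace, _root_.map_sum]
  have htr : Matrix.trace X = -σ (Matrix.trace X) := by
    conv_lhs => rw [hX']
    rw [Matrix.trace_neg, Matrix.trace_mul_cycle, Units.mul_inv, Matrix.one_mul, Matrix.trace_transpose, htrmap]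
  calc σ (Matrix.trace X) = -(-σ (Matrix.trace X)) := (neg_neg _).symm
    _ = -Matrix.trace X := by rw [← htr]

variable {σ}

/-- **THE CENTRE SPLITTING `↥K⁻ × ↥𝔲₀ ≃ₜ+ ↥𝔲`, `(z, Y) ↦ z • 1 + Y`** (∃-packaged, no definition): `K⁻ = ker (σ + id)` the skew scalars, inverse
`X ↦ (3⁻¹ · trace X, X − (3⁻¹ · trace X) • 1)` — `(3 : K) ≠ 0` is load-bearing (in characteristic `3` the centre lies inside `𝔲₀`); no continuity of `σ` is needed for the
splitting itself (it is needed later for closedness of the three carriers).  `z • 1 ∈ 𝔲 ↔ σ z = −z` needs nothing on `J`; `trace X ∈ K⁻` for `X ∈ 𝔲` needs `IsUnit J.det`. [cite: HarishChandra1970, Part VII §1 Thm. 15] -/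
theorem exists_centreSplitting {J : Matrix (Fin 3) (Fin 3) K} (hJd : IsUnit J.det) (h3 : (3 : K) ≠ 0)
    (𝔲 : AddSubgroup (Matrix (Fin 3) (Fin 3) K)) (h𝔲 : ∀ X, X ∈ 𝔲 ↔ (X.map σ)ᵀ * J + J * X = 0)
    (𝔲₀ : AddSubgroup (Matrix (Fin 3) (Fin 3) K)) (h𝔲₀ : ∀ X, X ∈ 𝔲₀ ↔ (X.map σ)ᵀ * J + J * X = 0 ∧ Matrix.trace X = 0) :
    ∃ e : ↥(((σ : K →+* K).toAddMonoidHom + AddMonoidHom.id K).ker) × ↥𝔲₀ ≃ₜ+ ↥𝔲,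
      ∀ (z : ↥(((σ : K →+* K).toAddMonoidHom + AddMonoidHom.id K).ker)) (Y : ↥𝔲₀),
        ((e (z, Y) : ↥𝔲) : Matrix (Fin 3) (Fin 3) K) = (z : K) • (1 : Matrix (Fin 3) (Fin 3) K) + (Y : Matrix (Fin 3) (Fin 3) K) := by
  classical
  set Z : AddSubgroup K := ((σ : K →+* K).toAddMonoidHom + AddMonoidHom.id K).ker with hZ
  have memZ : ∀ z : K, z ∈ Z ↔ σ z = -z := fun z => mem_ker_add_id_iff σ z
  -- membership facts
  have hsmul_mem : ∀ z : K, σ z = -z → z • (1 : Matrix (Fin 3) (Fin 3) K) ∈ 𝔲 := by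
    intro z hz
    rw [h𝔲]
    have hm : ((z • (1 : Matrix (Fin 3) (Fin 3) K)).map σ)ᵀ = σ z • (1 : Matrix (Fin 3) (Fin 3) K) := by
      ext i j
      simp only [Matrix.transpose_apply, Matrix.map_apply, Matrix.smul_apply, smul_eq_mul, map_mul, Matrix.one_apply]
      by_cases h : j = i
      · subst h; simp
      · rw [if_neg h, if_neg (Ne.symm h), map_zero]
    rw [hm, hz, Matrix.smul_mul, Matrix.mul_smul, Matrix.one_mul, Matrix.mul_one, neg_smul, neg_add_cancel]
  have htrZ : ∀ X : ↥𝔲, σ (Matrix.trace (X : Matrix (Fin 3) (Fin 3) K)) = -Matrix.trace (X : Matrix (Fin 3) (Fin 3) K) :=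
    fun X => map_trace_eq_neg_of_mem σ hJd ((h𝔲 _).1 X.2)
  have hσ3 : σ (3 : K)⁻¹ = (3 : K)⁻¹ := by rw [map_inv₀, map_ofNat]
  have hto_mem : ∀ p : ↥Z × ↥𝔲₀, ((p.1 : K) • (1 : Matrix (Fin 3) (Fin 3) K) + (p.2 : Matrix (Fin 3) (Fin 3) K)) ∈ 𝔲 := fun p =>
    𝔲.add_mem (hsmul_mem _ ((memZ _).1 p.1.2)) ((h𝔲 _).2 ((h𝔲₀ _).1 p.2.2).1)
  have hz_mem : ∀ X : ↥𝔲, (3 : K)⁻¹ * Matrix.trace (X : Matrix (Fin 3) (Fin 3) K) ∈ Z := by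
    intro X; rw [memZ, map_mul, hσ3, htrZ, mul_neg]
  have hY_mem : ∀ X : ↥𝔲, (X : Matrix (Fin 3) (Fin 3) K) - ((3 : K)⁻¹ * Matrix.trace (X : Matrix (Fin 3) (Fin 3) K)) • (1 : Matrix (Fin 3) (Fin 3) K) ∈ 𝔲₀ := by
    intro X
    rw [h𝔲₀]
    refine ⟨(h𝔲 _).1 (𝔲.sub_mem X.2 (hsmul_mem _ ((memZ _).1 (hz_mem X)))), ?_⟩
    rw [Matrix.trace_sub, Matrix.trace_smul, Matrix.trace_one, Fintype.card_fin, smul_eq_mul]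
    push_cast
    field_simp
    ring
  let eFun : ↥Z × ↥𝔲₀ → ↥𝔲 := fun p => ⟨(p.1 : K) • (1 : Matrix (Fin 3) (Fin 3) K) + (p.2 : Matrix (Fin 3) (Fin 3) K), hto_mem p⟩
  let eInv : ↥𝔲 → ↥Z × ↥𝔲₀ := fun X =>
    (⟨(3 : K)⁻¹ * Matrix.trace (X : Matrix (Fin 3) (Fin 3) K), hz_mem X⟩,
     ⟨(X : Matrix (Fin 3) (Fin 3) K) - ((3 : K)⁻¹ * Matrix.trace (X : Matrix (Fin 3) (Fin 3) K)) • (1 : Matrix (Fin 3) (Fin 3) K), hY_mem X⟩)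
  have hleft : Function.LeftInverse eInv eFun := by
    rintro ⟨⟨z, hz⟩, ⟨Y, hY⟩⟩
    have hY0 : Matrix.trace Y = 0 := ((h𝔲₀ _).1 hY).2
    have htr : (3 : K)⁻¹ * Matrix.trace (z • (1 : Matrix (Fin 3) (Fin 3) K) + Y) = z := by
      rw [Matrix.trace_add, Matrix.trace_smul, Matrix.trace_one, Fintype.card_fin, hY0, smul_eq_mul, add_zero]
      push_cast
      field_simp
    refine Prod.ext (Subtype.ext ?_) (Subtype.ext ?_)
    · exact htr
    · change z • (1 : Matrix (Fin 3) (Fin 3) K) + Y - ((3 : K)⁻¹ * Matrix.trace (z • (1 : Matrix (Fin 3) (Fin 3) K) + Y)) • (1 : Matrix (Fin 3) (Fin 3) K) = Y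
      rw [htr]; abel
  have hright : Function.RightInverse eInv eFun := by
    intro X
    apply Subtype.ext
    change ((3 : K)⁻¹ * Matrix.trace (X : Matrix (Fin 3) (Fin 3) K)) • (1 : Matrix (Fin 3) (Fin 3) K) +
        ((X : Matrix (Fin 3) (Fin 3) K) - ((3 : K)⁻¹ * Matrix.trace (X : Matrix (Fin 3) (Fin 3) K)) • (1 : Matrix (Fin 3) (Fin 3) K)) = X
    abel
  have hcont : Continuous eFun := by
    refine Continuous.subtype_mk ?_ _
    exact ((continuous_subtype_val.comp continuous_fst).smul continuous_const).add (continuous_subtype_val.comp continuous_snd)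
  have hcontInv : Continuous eInv := by
    have htrc : Continuous fun X : ↥𝔲 => (3 : K)⁻¹ * Matrix.trace (X : Matrix (Fin 3) (Fin 3) K) :=
      continuous_const.mul (continuous_subtype_val.matrix_trace)
    refine Continuous.prodMk (htrc.subtype_mk _) (Continuous.subtype_mk ?_ _)
    exact continuous_subtype_val.sub (htrc.smul continuous_const)
  refine ⟨{ toFun := eFun
            invFun := eInv
            left_inv := hleft
            right_inv := hright
            map_add' := ?_
            continuous_toFun := hcont
            continuous_invFun := hcontInv }, fun z Y => rfl⟩
  rintro ⟨⟨z, hz⟩, ⟨Y, hY⟩⟩ ⟨⟨z', hz'⟩, ⟨Y', hY'⟩⟩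
  apply Subtype.ext
  change (z + z') • (1 : Matrix (Fin 3) (Fin 3) K) + (Y + Y') = (z • (1 : Matrix (Fin 3) (Fin 3) K) + Y) + (z' • (1 : Matrix (Fin 3) (Fin 3) K) + Y')
  rw [add_smul]; abel

/-- **CENTRE-FUBINI (GLOBAL `↥𝔲₀ ⇒ ↥𝔲`).**  `σ : K →+* K` continuous (no involution property is needed here), `J` with invertible determinant, `(3 : K) ≠ 0`; `𝔲`, `𝔲₀` the R3 carriers with ANY additive Haar measures
`μ`, `μ₀`.  If `ηι` is locally `∫⁻`-finite at every point of `↥𝔲₀`, then at every point of `↥𝔲`: along `e : ↥K⁻ × ↥𝔲₀ ≃ₜ+ ↥𝔲`, `e (z, Y) = z • 1 + Y` (inverse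
`X ↦ (trace X ∕ 3, X − (trace X ∕ 3) • 1)`), `ηι (z • 1 + Y) = ηι Y` (★ `discr_add_smul_one_fin_three`), and ★ (G-FUB) transfers local finiteness (Haar uniqueness absorbs the
constants). [cite: HarishChandra1970, Part VII §1 Thm. 15] [cite: Folland1999, §11.1 Thm. 11.9] -/
theorem forall_exists_nhds_setLIntegral_etaInv_lt_top_of_traceZero (hσc : Continuous σ)
    {J : Matrix (Fin 3) (Fin 3) K} (hJd : IsUnit J.det) (h3 : (3 : K) ≠ 0)
    (𝔲 : AddSubgroup (Matrix (Fin 3) (Fin 3) K)) (h𝔲 : ∀ X, X ∈ 𝔲 ↔ (X.map σ)ᵀ * J + J * X = 0)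
    (𝔲₀ : AddSubgroup (Matrix (Fin 3) (Fin 3) K)) (h𝔲₀ : ∀ X, X ∈ 𝔲₀ ↔ (X.map σ)ᵀ * J + J * X = 0 ∧ Matrix.trace X = 0)
    [MeasurableSpace ↥𝔲₀] [BorelSpace ↥𝔲₀] (μ₀ : Measure ↥𝔲₀) [μ₀.IsAddHaarMeasure]
    [MeasurableSpace ↥𝔲] [BorelSpace ↥𝔲] (μ : Measure ↥𝔲) [μ.IsAddHaarMeasure]
    (h0 : ∀ X₀ : ↥𝔲₀, ∃ U ∈ 𝓝 X₀,
      ∫⁻ X in U, ((NNReal.sqrt (NNReal.sqrt (IsNonarchimedeanLocalField.normAbs K (Matrix.charpoly (X : Matrix (Fin 3) (Fin 3) K)).discr)) : ℝ≥0∞))⁻¹ ∂μ₀ < ∞) :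
    ∀ X₀ : ↥𝔲, ∃ U ∈ 𝓝 X₀,
      ∫⁻ X in U, ((NNReal.sqrt (NNReal.sqrt (IsNonarchimedeanLocalField.normAbs K (Matrix.charpoly (X : Matrix (Fin 3) (Fin 3) K)).discr)) : ℝ≥0∞))⁻¹ ∂μ < ∞ := by
  classical
  haveI : T2Space K := (IsNonarchimedeanLocalField.isLocalField K).toT2Space
  haveI := secondCountableTopology_localField K
  -- the skew scalars: closed, hence locally compact; Borel structure and a Haar measure
  set Z : AddSubgroup K := ((σ : K →+* K).toAddMonoidHom + AddMonoidHom.id K).ker with hZ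
  have memZ : ∀ z : K, z ∈ Z ↔ σ z = -z := fun z => mem_ker_add_id_iff σ z
  have hZc : IsClosed (Z : Set K) := by
    have : (Z : Set K) = {z | σ z + z = 0} := by
      ext z; rw [SetLike.mem_coe, memZ, Set.mem_setOf_eq, add_eq_zero_iff_eq_neg]
    rw [this]
    exact isClosed_eq (hσc.add continuous_id) continuous_const
  letI : MeasurableSpace ↥Z := borel ↥Z
  haveI : BorelSpace ↥Z := ⟨rfl⟩
  haveI : LocallyCompactSpace ↥Z := hZc.locallyCompactSpace
  haveI : SecondCountableTopology ↥Z := TopologicalSpace.Subtype.secondCountableTopology _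
  -- `𝔲`, `𝔲₀` are closed, hence locally compact
  have hlin : Continuous fun X : Matrix (Fin 3) (Fin 3) K => (X.map σ)ᵀ * J + J * X := by
    have hmap : Continuous fun X : Matrix (Fin 3) (Fin 3) K => X.map σ := continuous_id.matrix_map hσc
    exact (hmap.matrix_transpose.matrix_mul continuous_const).add (continuous_const.matrix_mul continuous_id)
  have h𝔲c : IsClosed (𝔲 : Set (Matrix (Fin 3) (Fin 3) K)) := by
    have : (𝔲 : Set (Matrix (Fin 3) (Fin 3) K)) = (fun X : Matrix (Fin 3) (Fin 3) K => (X.map σ)ᵀ * J + J * X) ⁻¹' {0} := by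
      ext X; rw [SetLike.mem_coe, h𝔲]; rfl
    rw [this]; exact isClosed_singleton.preimage hlin
  have h𝔲₀c : IsClosed (𝔲₀ : Set (Matrix (Fin 3) (Fin 3) K)) := by
    have : (𝔲₀ : Set (Matrix (Fin 3) (Fin 3) K)) =
        (fun X : Matrix (Fin 3) (Fin 3) K => (X.map σ)ᵀ * J + J * X) ⁻¹' {0} ∩ (fun X : Matrix (Fin 3) (Fin 3) K => Matrix.trace X) ⁻¹' {0} := by
      ext X; rw [SetLike.mem_coe, h𝔲₀]; rfl
    rw [this]
    exact (isClosed_singleton.preimage hlin).inter (isClosed_singleton.preimage (continuous_id.matrix_trace))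
  haveI : LocallyCompactSpace (Matrix (Fin 3) (Fin 3) K) := inferInstanceAs (LocallyCompactSpace (Fin 3 → Fin 3 → K))
  haveI : SecondCountableTopology (Matrix (Fin 3) (Fin 3) K) := inferInstanceAs (SecondCountableTopology (Fin 3 → Fin 3 → K))
  haveI : LocallyCompactSpace ↥𝔲 := h𝔲c.locallyCompactSpace
  haveI : LocallyCompactSpace ↥𝔲₀ := h𝔲₀c.locallyCompactSpace
  haveI : SecondCountableTopology ↥𝔲 := TopologicalSpace.Subtype.secondCountableTopology _
  haveI : SecondCountableTopology ↥𝔲₀ := TopologicalSpace.Subtype.secondCountableTopology _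
  -- the splitting and the invariance of the integrand along the centre
  obtain ⟨e, he⟩ := exists_centreSplitting hJd h3 𝔲 h𝔲 𝔲₀ h𝔲₀
  set f : ↥𝔲 → ℝ≥0∞ := fun X =>
    ((NNReal.sqrt (NNReal.sqrt (IsNonarchimedeanLocalField.normAbs K (Matrix.charpoly (X : Matrix (Fin 3) (Fin 3) K)).discr)) : ℝ≥0∞))⁻¹ with hfdef
  set g : ↥𝔲₀ → ℝ≥0∞ := fun Y =>
    ((NNReal.sqrt (NNReal.sqrt (IsNonarchimedeanLocalField.normAbs K (Matrix.charpoly (Y : Matrix (Fin 3) (Fin 3) K)).discr)) : ℝ≥0∞))⁻¹ with hgdef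
  have hfg : ∀ (z : ↥Z) (Y : ↥𝔲₀), f (e (z, Y)) = g Y := by
    intro z Y
    simp only [hfdef, hgdef]
    have hd : (Matrix.charpoly ((e (z, Y) : ↥𝔲) : Matrix (Fin 3) (Fin 3) K)).discr = (Matrix.charpoly (Y : Matrix (Fin 3) (Fin 3) K)).discr := by
      rw [he, add_comm]; exact discr_add_smul_one_fin_three _ _
    rw [hd]
  have hg : Measurable g := measurable_etaInv_subtype 𝔲₀
  exact (forall_exists_nhds_setLIntegral_lt_top_iff_of_prod e μ₀ μ (Measure.addHaar : Measure ↥Z) hg hfg).2 h0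

end Centre

/-! ## §4 The combined head: GLOBAL on `↥𝔲` from the local inputs and the (CO) letters -/

/-- **GLOBAL ON THE UNITARY LIE ALGEBRA `↥𝔲` (ROAD «HC-D», D5(iv)+GLOBAL).**  From D5(i) (`hreg`), D5(ii)+(iii) (`hnonreg`) on the trace-zero part and the (CO) coordinate
letters (`ι`, norm bridge, `Φ₀` with scaling equivariance): `ηι = |η|^{−1∕2}` is locally `∫⁻`-finite at every point of `↥𝔲`, for ANY additive Haar measures `μ₀`, `μ`
(§1 + §2 + §3).  D6(a) ∕ D7 consume this head (then ★ (G-FUB) `locallyIntegrable_of_enorm_le_…` for the `hDGliO` token).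
[cite: HarishChandra1970, Part VII §1 Thm. 15] [cite: Folland1999, §11.1 Thm. 11.9] -/
theorem forall_exists_nhds_setLIntegral_etaInv_lt_top_of_local
    {σ : K →+* K} (hσc : Continuous σ)
    {J : Matrix (Fin 3) (Fin 3) K} (hJd : IsUnit J.det) (h3 : (3 : K) ≠ 0)
    (𝔲 : AddSubgroup (Matrix (Fin 3) (Fin 3) K)) (h𝔲 : ∀ X, X ∈ 𝔲 ↔ (X.map σ)ᵀ * J + J * X = 0)
    (𝔲₀ : AddSubgroup (Matrix (Fin 3) (Fin 3) K)) (h𝔲₀ : ∀ X, X ∈ 𝔲₀ ↔ (X.map σ)ᵀ * J + J * X = 0 ∧ Matrix.trace X = 0)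
    [MeasurableSpace ↥𝔲₀] [BorelSpace ↥𝔲₀] (μ₀ : Measure ↥𝔲₀) [μ₀.IsAddHaarMeasure]
    [MeasurableSpace ↥𝔲] [BorelSpace ↥𝔲] (μ : Measure ↥𝔲) [μ.IsAddHaarMeasure]
    {F' : Type*} [Field F'] [ValuativeRel F'] [TopologicalSpace F'] [IsNonarchimedeanLocalField F']
    (ι : F' →+* K) (hιn : ∀ x : F', IsNonarchimedeanLocalField.normAbs K (ι x) = IsNonarchimedeanLocalField.normAbs F' x ^ 2)
    (Φ₀ : (Fin 8 → F') ≃ₜ+ ↥𝔲₀)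
    (hΦ₀ : ∀ (l : F') (a : Fin 8 → F'), ((Φ₀ (l • a) : ↥𝔲₀) : Matrix (Fin 3) (Fin 3) K) = ι l • ((Φ₀ a : ↥𝔲₀) : Matrix (Fin 3) (Fin 3) K))
    (hreg : ∀ X₀ : ↥𝔲₀, LinearIndependent K ![(1 : Matrix (Fin 3) (Fin 3) K), (X₀ : Matrix (Fin 3) (Fin 3) K), (X₀ : Matrix (Fin 3) (Fin 3) K) ^ 2] →
      ∃ U ∈ 𝓝 X₀, ∫⁻ X in U, ((NNReal.sqrt (NNReal.sqrt (IsNonarchimedeanLocalField.normAbs K (Matrix.charpoly (X : Matrix (Fin 3) (Fin 3) K)).discr)) : ℝ≥0∞))⁻¹ ∂μ₀ < ∞)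
    (hnonreg : ∀ X₀ : ↥𝔲₀, X₀ ≠ 0 → ¬ LinearIndependent K ![(1 : Matrix (Fin 3) (Fin 3) K), (X₀ : Matrix (Fin 3) (Fin 3) K), (X₀ : Matrix (Fin 3) (Fin 3) K) ^ 2] →
      ∃ U ∈ 𝓝 X₀, ∫⁻ X in U, ((NNReal.sqrt (NNReal.sqrt (IsNonarchimedeanLocalField.normAbs K (Matrix.charpoly (X : Matrix (Fin 3) (Fin 3) K)).discr)) : ℝ≥0∞))⁻¹ ∂μ₀ < ∞) :
    ∀ X₀ : ↥𝔲, ∃ U ∈ 𝓝 X₀,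
      ∫⁻ X in U, ((NNReal.sqrt (NNReal.sqrt (IsNonarchimedeanLocalField.normAbs K (Matrix.charpoly (X : Matrix (Fin 3) (Fin 3) K)).discr)) : ℝ≥0∞))⁻¹ ∂μ < ∞ :=
  forall_exists_nhds_setLIntegral_etaInv_lt_top_of_traceZero hσc hJd h3 𝔲 h𝔲 𝔲₀ h𝔲₀ μ₀ μ
    (forall_exists_nhds_setLIntegral_etaInv_lt_top_traceZero 𝔲₀ μ₀ hreg hnonreg
      (forall_exists_nhds_setLIntegral_etaInv_lt_top_traceZero_of_off_zero 𝔲₀ μ₀ ι hιn Φ₀ hΦ₀))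

end Summit.HodgeConjecture.HodgeConjecture.Cruxes.H413.F0P3cStCharTSHCDLieGlobal

end
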